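import Summits.BirchSwinnertonDyer.BirchSwinnertonDyer.Theorems.KolyvaginRoadThreeMethod2Step
import Summits.BirchSwinnertonDyer.BirchSwinnertonDyer.Theorems.KolyvaginRoadThreeMethod2Basics
import Summits.BirchSwinnertonDyer.BirchSwinnertonDyer.Theorems.KolyvaginRoadThreeZhangRankLowering
import Summits.BirchSwinnertonDyer.BirchSwinnertonDyer.Theses.KolyvaginRoadThree
import HarnessLib

/-!
# Route `KolyvaginRoadThree`, deciding crux `ZhangSharpFrameAtThreeHL` (item stmt-BirchSwinnertonDyer-19574):
# the (A1) RANK-LOWERING conjunct of the registered stub `stub_levelRaisingAtThree` (METHOD skeleton v2t) for the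
# CANONICAL level-raised Selmer spaces `SelQ`, REDUCED to five local–global inputs at ONE unipotent-admissible prime
# (cell `bsd-stepL`, seat `bsd-stepL-koly3a` g0, ACCEL-LIST (9); `--supports stmt-BirchSwinnertonDyer-19574`, helper)

HONEST FRAMING. Structural theorems; no definition, no named fact, no `sorry`; nothing is booked; the stub is NOT
proved. The registered stub A of crux 19574 (`…Cruxes.ZhangSharpFrameAtThreeHL.Method2.stub_levelRaisingAtThree`,
plan g26 v2t d2cc5d83, text = zhang3-p1's v2s repair of koly g11's v2) asks, at every Hoffstein–Luo A1 frame, for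
(A1) RANK LOWERING of the canonical spaces `SelQ W K c n μ ⊂ H¹(K, E[3])` (`Theorems/KolyvaginRoadThreeMethod2Defs`,
p456348) by raising the level at ONE new unipotent-admissible prime, with W. Zhang's (9.1)–(9.2) eigen-bookkeeping,
and (A6⁰) non-zero total rank at even levels. This file proves the (A1) conjunct VERBATIM (`selQ_rankLowering_of_
localGlobal`) from FIVE inputs, each a statement about the TRUE objects (the tree's localisation map
`WeierstrassCurve.torsionLocMap` at the place `v ∣ q`, E's Kummer condition `selmerLocalKer`, the ordinary condition
`WeierstrassCurve.ordinaryLocalKer`, complex conjugation `conjAct W c`), each strictly smaller than (A1) and each the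
content of one printed lemma (referee g30 R2 ∕ R4; koly MEMO-v1–v2 at p = 3):

* (Cheb) ČEBOTAREV WITH THE SIGN RULE [W. Zhang 2014 Lemma 7.3 — the only `p ≥ 5` of the §9 chain —, BD05 Thm 3.2;
  at 3: koly U3 `UAdm.isUnit_one_add`]: a non-zero class of `SelQ n μ` has non-zero localisation at (the place above)
  some unipotent-admissible `q ∉ n`;
* (Equiv) COMPLEX CONJUGATION ACTS ON `H¹(K_q, E[3])` BY A SCALAR SIGN `ε_q` and `loc_q` is equivariant [Zhang
  (9.2) «compatible with the action of complex conjugation»; `q` inert ⇒ `τ|_{K_q} = Frob_q = ε_q·u`, `u` unipotent];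
* (Line) THE KUMMER IMAGE AT `q` IS A LINE [BD05 Lemma 2.6 ∕ koly U1 `UAdm.finrank_ker_sub_one_eq_one`:
  `H¹_fin(K_q, E[3]) = E[3]/(u − 1)E[3]` is cyclic]: the localisations of the classes Kummer at `q` are multiples of
  one local class;
* (Trans) KUMMER ∩ ORDINARY = 0 AT `q` [BD05 Lemma 2.6 `H¹ = H¹_fin ⊕ H¹_ord` ∕ koly U4 `UAdm.mul_self_ne_one`]: a
  local class that is a multiple of a Kummer localisation and ordinary is zero;
* (Iso) POITOU–TATE ISOTROPY [global reciprocity for the cup product + local Tate duality on the plane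
  `H¹(K_q, E[3])`; Zhang Prop. 5.4 ∕ Gross–Parson]: the localisations at `q` of any two classes of the space RELAXED
  at `q` (`SelRelQ (n ∪ {q}) {q} μ`) are proportional.
From these: the sign of the detecting prime is forced (so `loc_q` kills the `−μ`-eigenspace, (9.2) as a SUBSPACE
equality, R2), `SelQ (n∪{q}) μ = SelQ n μ ⊓ ker loc_q` (zhang3-p1's one-prime step p457790 + (Iso) + (Trans)), and
codimension one (`ZhangInduction.finrank_inf_ker_add_one_of_line`, p455830). `stub_levelRaisingAtThree_of_localGlobal`:
the REGISTERED stub signature VERBATIM from the five inputs + (A6⁰) frame-wise (CONDITIONAL; the owner assembles).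
PARTITION: O2@3 (B10) × A1 × crux 19574 — none (reduction of a registered stub to named inputs; closes nothing; T7).
References: [cite: WZhang2014, Prop. 5.4, Lemma 7.3, §9 (9.1)–(9.3)] [cite: BertoliniDarmon2005, Lemma 2.6, Thm. 3.2].
-/

noncomputable section

open scoped Classical

namespace Summit.BirchSwinnertonDyer.Rank1Residual.X11b.Three.Koly.Method2

open WeierstrassCurve NumberField IsDedekindDomain
  Literature.NumberTheory.EllipticCurves Literature.NumberTheory.EllipticCurves.ModularForms
  Literature.NumberTheory.GaloisRepresentations Module

variable (W : WeierstrassCurve ℚ) (K : Type) [Field K] [NumberField K] (c : K ≃ₐ[ℚ] K)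

/-! ## §0 Bookkeeping: the place above an inert prime; zero classes are Kummer and ordinary -/

/-- **An inert rational prime has exactly one place above it**: if `(q) ⊂ 𝓞_K` is prime and `q ≠ 0`, every finite
place `v` with `q ∈ v` IS `(q)` (a non-zero prime of a Dedekind domain is maximal). [folklore] -/
theorem asIdeal_eq_span_of_isPrime_span {q : ℕ} (hq : (Ideal.span {(q : 𝓞 K)}).IsPrime) (hq0 : q ≠ 0)
    (v : HeightOneSpectrum (𝓞 K)) (hv : (q : 𝓞 K) ∈ v.asIdeal) : v.asIdeal = Ideal.span {(q : 𝓞 K)} := by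
  have hle : Ideal.span {(q : 𝓞 K)} ≤ v.asIdeal := by
    rw [Ideal.span_le, Set.singleton_subset_iff]
    exact hv
  have hne : Ideal.span {(q : 𝓞 K)} ≠ ⊥ := by
    rw [Ne, Ideal.span_singleton_eq_bot]
    exact_mod_cast hq0
  exact ((hq.isMaximal hne).eq_of_le v.isPrime.ne_top hle).symm

/-- **Two places above an inert prime coincide.** [folklore] -/
theorem placesAbove_eq_of_isPrime_span {q : ℕ} (hq : (Ideal.span {(q : 𝓞 K)}).IsPrime) (hq0 : q ≠ 0)
    {v v' : HeightOneSpectrum (𝓞 K)} (hv : (q : 𝓞 K) ∈ v.asIdeal) (hv' : (q : 𝓞 K) ∈ v'.asIdeal) : v' = v :=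
  HeightOneSpectrum.ext (by rw [asIdeal_eq_span_of_isPrime_span K hq hq0 v hv,
    asIdeal_eq_span_of_isPrime_span K hq hq0 v' hv'])

/-- **A class with localisation ZERO at `v` satisfies the ordinary condition at `v`** (the zero class is represented
by the zero cocycle, which is valued in the fixed points). [cite: BertoliniDarmon2005, §2.2] -/
theorem torsionLocalKer_le_ordinaryLocalKer (E : Type) [Field E] [Algebra K E] (n : ℤ) :
    (W.baseChange K).torsionLocalKer E n ≤ (W.baseChange K).ordinaryLocalKer E n := by
  intro x hx
  change (W.baseChange K).torsionLocMap E n x = 0 at hx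
  change x ∈ AddSubgroup.comap _ _
  rw [AddSubgroup.mem_comap, hx]
  exact AddSubgroup.zero_mem _

/-! ## §1 The sign of a detecting prime is forced (Zhang (9.2), additive form) -/

/-- **A localisation equivariant for complex conjugation with the WRONG sign vanishes**: if `τ x = sgn ν • x`,
`loc (τ z) = sgn s • loc z` for all `z`, `s ≠ ν` and `3 • loc x = 0` (a class of `H¹(K_v, E[3])`), then `loc x = 0`
(`loc x = −loc x`, and `3 · loc x = 0`). [cite: WZhang2014, §9 (9.2)] -/
theorem loc_eq_zero_of_sign_ne {A B : Type*} [AddCommGroup A] [AddCommGroup B] (τ : A →+ A) (loc : A →+ B)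
    {s ν : Bool} (hequiv : ∀ z, loc (τ z) = sgn s • loc z) {x : A} (hx : τ x = sgn ν • x) (hne : s ≠ ν)
    (h3 : (3 : ℤ) • loc x = 0) : loc x = 0 := by
  have h := hequiv x
  rw [hx, map_zsmul] at h
  -- in either case `loc x = - loc x`
  have hself : loc x = -loc x := by
    cases s <;> cases ν <;> simp only [sgn, ite_true, ite_false, Bool.false_eq_true, neg_smul, one_smul] at h hne
    · exact absurd rfl hne
    · exact h
    · exact h.symm
    · exact absurd rfl hne
  have h2 : (2 : ℤ) • loc x = 0 := by
    rw [two_zsmul]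
    nth_rewrite 1 [hself]
    exact neg_add_cancel _
  calc loc x = ((3 : ℤ) - 2) • loc x := by norm_num
    _ = (3 : ℤ) • loc x - (2 : ℤ) • loc x := sub_smul _ _ _
    _ = 0 := by rw [h3, h2, sub_zero]


/-! ## §2 Unfolding the canonical spaces at the place above a new admissible prime -/

section Unfold

variable [W.IsGloballyMinimal] [Module (ZMod 3) (V3 W K)]

/-- A class of `SelQ n ν` lies in the `sgn ν`-eigenspace of complex conjugation. [cite: WZhang2014, §5] -/
theorem conjAct_eq_of_mem_selQ (n : Finset {q // IsUAdmissiblePrime W K q}) (ν : Bool) {y : V3 W K}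
    (hy : y ∈ SelQ W K c n ν) : conjAct W c ((3 ^ 1 : ℕ) : ℤ) y = sgn ν • y := by
  unfold SelQ at hy
  rw [AddSubgroup.mem_toZModSubmodule] at hy
  have h1 := (AddSubgroup.mem_inf.mp hy).1
  rw [AddMonoidHom.mem_ker, AddMonoidHom.sub_apply, sub_eq_zero] at h1
  exact h1

/-- **A level-`n` class is KUMMER above a unipotent-admissible `q ∉ n`** (the places above `q` lie above no prime
of `n`). [cite: WZhang2014, §5 (Sel_{𝔭_n})] -/
theorem mem_selmerLocalKer_of_mem_selQ (n : Finset {q // IsUAdmissiblePrime W K q})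
    (q : {q // IsUAdmissiblePrime W K q}) (hqn : q ∉ n) (v : HeightOneSpectrum (𝓞 K))
    (hv : ((q : ℕ) : 𝓞 K) ∈ v.asIdeal) (ν : Bool) {y : V3 W K} (hy : y ∈ SelQ W K c n ν) :
    y ∈ selmerLocalKer (W.baseChange K) (v.adicCompletion K) ((3 ^ 1 : ℕ) : ℤ) := by
  unfold SelQ at hy
  rw [AddSubgroup.mem_toZModSubmodule] at hy
  have h3 := (AddSubgroup.mem_inf.mp (AddSubgroup.mem_inf.mp (AddSubgroup.mem_inf.mp hy).2).2).1
  rw [AddSubgroup.mem_iInf] at h3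
  have h3v := h3 v
  rw [AddSubgroup.mem_iInf] at h3v
  refine h3v fun q' hq' ↦ ?_
  have hdisj := disjoint_places_of_uAdmissible W K n ∅ q hqn (Set.notMem_empty _) v hv q'
  rw [Set.image_empty] at hdisj
  exact hdisj hq'

/-- **A level-`(n ∪ {q})` class is ORDINARY above `q`.** [cite: WZhang2014, §5 (Sel_{𝔭_n})] -/
theorem mem_ordinaryLocalKer_of_mem_selQ_insert (n : Finset {q // IsUAdmissiblePrime W K q})
    (q : {q // IsUAdmissiblePrime W K q}) (v : HeightOneSpectrum (𝓞 K)) (hv : ((q : ℕ) : 𝓞 K) ∈ v.asIdeal)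
    (ν : Bool) {y : V3 W K} (hy : y ∈ SelQ W K c (insert q n) ν) :
    y ∈ (W.baseChange K).ordinaryLocalKer (v.adicCompletion K) ((3 ^ 1 : ℕ) : ℤ) := by
  unfold SelQ at hy
  rw [AddSubgroup.mem_toZModSubmodule] at hy
  have h4 := (AddSubgroup.mem_inf.mp (AddSubgroup.mem_inf.mp (AddSubgroup.mem_inf.mp hy).2).2).2
  rw [AddSubgroup.mem_iInf] at h4
  have h4q := h4 (q : ℕ)
  rw [AddSubgroup.mem_iInf] at h4q
  have h4q' := h4q ⟨Finset.mem_image_of_mem _ (Finset.mem_insert_self q n), Set.notMem_empty _⟩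
  rw [AddSubgroup.mem_iInf] at h4q'
  have h4v := h4q' v
  rw [AddSubgroup.mem_iInf] at h4v
  exact h4v hv

end Unfold

/-! ## §3 The (A1) conjunct of `stub_levelRaisingAtThree` from the five local–global inputs -/

section RankLowering

variable [W.IsElliptic] [W.IsGloballyMinimal] [Module (ZMod 3) (V3 W K)]

/-- **RANK LOWERING for the canonical spaces `SelQ` from (Cheb) + (Equiv) + (Line) + (Trans) + (Iso).** The
conclusion is VERBATIM the (A1) conjunct of the registered stub `stub_levelRaisingAtThree` (v2t): every non-zero
class `x ∈ SelQ n μ` is killed at some new unipotent-admissible `q`, with `SelQ (n∪{q}) μ ≤ SelQ n μ` of codimension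
exactly one and `SelQ (n∪{q}) (−μ) = SelQ n (−μ)`. Inputs (module docstring): (Cheb) a non-zero class of `SelQ n μ`
is detected by the localisation at some unipotent-admissible `q ∉ n` [Zhang Lemma 7.3 ∕ BD05 Thm 3.2 ∕ koly U3];
(Equiv) complex conjugation acts on `H¹(K_q, E[3])` by a scalar sign and `loc_q` is equivariant [Zhang (9.2)];
(Line) the localisations of the Kummer-at-`q` classes are multiples of one local class [BD05 L.2.6 ∕ koly U1];
(Trans) a multiple of a Kummer localisation which is ordinary vanishes [BD05 L.2.6 ∕ koly U4]; (Iso) the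
localisations at `q` of two classes relaxed at `q` are proportional [Poitou–Tate; Zhang Prop 5.4]. Proof: the sign of
`q` is forced to be `μ` (`loc_eq_zero_of_sign_ne` at `x`), so `loc_q` kills every `−μ`-eigenclass; the one-prime step
`selQ_insert_inf_kummer_eq` (zhang3-p1) + (Iso) + (Trans) give `SelQ (n∪{q}) μ = SelQ n μ ⊓ ker loc_q` and, with the
vanishing on the `−μ`-side, `SelQ (n∪{q}) (−μ) = SelQ n (−μ)`; rank–nullity against the line (Line)
(`ZhangInduction.finrank_inf_ker_add_one_of_line`) gives codimension one. CONDITIONAL on the five binders; nothing is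
booked. [cite: WZhang2014, Prop. 5.4, Lemma 7.3, §9 (9.1)–(9.3)] [cite: BertoliniDarmon2005, Lemma 2.6, Thm. 3.2] -/
theorem selQ_rankLowering_of_localGlobal
    -- (Cheb) Čebotarev with the sign rule
    (hcheb : ∀ (n : Finset {q // IsUAdmissiblePrime W K q}) (μ : Bool) (x : V3 W K), x ∈ SelQ W K c n μ → x ≠ 0 →
      ∃ q : {q // IsUAdmissiblePrime W K q}, q ∉ n ∧ ∃ v : HeightOneSpectrum (𝓞 K),
        ((q : ℕ) : 𝓞 K) ∈ v.asIdeal ∧ (W.baseChange K).torsionLocMap (v.adicCompletion K) ((3 ^ 1 : ℕ) : ℤ) x ≠ 0)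
    -- (Equiv) complex conjugation acts on H¹(K_q, E[3]) by the scalar sign of q, equivariantly
    (hequiv : ∀ q : {q // IsUAdmissiblePrime W K q}, ∃ s : Bool, ∀ v : HeightOneSpectrum (𝓞 K),
      ((q : ℕ) : 𝓞 K) ∈ v.asIdeal → ∀ z : V3 W K,
        (W.baseChange K).torsionLocMap (v.adicCompletion K) ((3 ^ 1 : ℕ) : ℤ) (conjAct W c ((3 ^ 1 : ℕ) : ℤ) z) =
          sgn s • (W.baseChange K).torsionLocMap (v.adicCompletion K) ((3 ^ 1 : ℕ) : ℤ) z)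
    -- (Line) the Kummer image at q is a line
    (hline : ∀ (q : {q // IsUAdmissiblePrime W K q}) (v : HeightOneSpectrum (𝓞 K)), ((q : ℕ) : 𝓞 K) ∈ v.asIdeal →
      ∃ ℓ, ∀ y ∈ selmerLocalKer (W.baseChange K) (v.adicCompletion K) ((3 ^ 1 : ℕ) : ℤ),
        ∃ a : ℤ, (W.baseChange K).torsionLocMap (v.adicCompletion K) ((3 ^ 1 : ℕ) : ℤ) y = a • ℓ)
    -- (Trans) Kummer ∩ ordinary = 0 at q
    (htrans : ∀ (q : {q // IsUAdmissiblePrime W K q}) (v : HeightOneSpectrum (𝓞 K)), ((q : ℕ) : 𝓞 K) ∈ v.asIdeal →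
      ∀ y z : V3 W K, y ∈ selmerLocalKer (W.baseChange K) (v.adicCompletion K) ((3 ^ 1 : ℕ) : ℤ) →
        z ∈ (W.baseChange K).ordinaryLocalKer (v.adicCompletion K) ((3 ^ 1 : ℕ) : ℤ) →
        (∃ a : ℤ, (W.baseChange K).torsionLocMap (v.adicCompletion K) ((3 ^ 1 : ℕ) : ℤ) z =
          a • (W.baseChange K).torsionLocMap (v.adicCompletion K) ((3 ^ 1 : ℕ) : ℤ) y) →
        (W.baseChange K).torsionLocMap (v.adicCompletion K) ((3 ^ 1 : ℕ) : ℤ) z = 0)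
    -- (Iso) Poitou–Tate isotropy of the image of the space relaxed at q
    (hiso : ∀ (n : Finset {q // IsUAdmissiblePrime W K q}) (q : {q // IsUAdmissiblePrime W K q}) (μ : Bool),
      q ∉ n → ∀ v : HeightOneSpectrum (𝓞 K), ((q : ℕ) : 𝓞 K) ∈ v.asIdeal →
      ∀ y ∈ SelRelQ W K c (insert q n) {q} μ, ∀ z ∈ SelRelQ W K c (insert q n) {q} μ,
        (W.baseChange K).torsionLocMap (v.adicCompletion K) ((3 ^ 1 : ℕ) : ℤ) z ≠ 0 →
        ∃ a : ℤ, (W.baseChange K).torsionLocMap (v.adicCompletion K) ((3 ^ 1 : ℕ) : ℤ) y =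
          a • (W.baseChange K).torsionLocMap (v.adicCompletion K) ((3 ^ 1 : ℕ) : ℤ) z) :
    ∀ (n : Finset {q // IsUAdmissiblePrime W K q}) (μ : Bool) (x : V3 W K),
      x ∈ SelQ W K c n μ → x ≠ 0 →
      ∃ q : {q // IsUAdmissiblePrime W K q}, q ∉ n ∧ x ∉ SelQ W K c (insert q n) μ ∧
        SelQ W K c (insert q n) μ ≤ SelQ W K c n μ ∧
        finrank (ZMod 3) (SelQ W K c (insert q n) μ) + 1 = finrank (ZMod 3) (SelQ W K c n μ) ∧
        SelQ W K c (insert q n) (!μ) = SelQ W K c n (!μ) := by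
  intro n μ x hx hx0
  obtain ⟨q, hqn, v, hv, hvx⟩ := hcheb n μ x hx hx0
  set loc := (W.baseChange K).torsionLocMap (v.adicCompletion K) ((3 ^ 1 : ℕ) : ℤ) with hloc
  -- the place above the inert prime q is unique
  have hq0 : (q : ℕ) ≠ 0 := q.2.1.ne_zero
  have hqP : (Ideal.span {((q : ℕ) : 𝓞 K)}).IsPrime := q.2.2.2.2.2.1
  have huniq : ∀ v' : HeightOneSpectrum (𝓞 K), ((q : ℕ) : 𝓞 K) ∈ v'.asIdeal → v' = v :=
    fun v' hv' ↦ placesAbove_eq_of_isPrime_span K hqP hq0 hv hv'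
  -- local classes are 3-torsion
  have h3loc : ∀ z : V3 W K, (3 : ℤ) • loc z = 0 := fun z ↦ by
    have h := zsmul_discreteH1_torsion ((3 ^ 1 : ℕ) : ℤ) (loc z)
    simpa using h
  -- the sign of q is forced to be μ
  obtain ⟨s, hs⟩ := hequiv q
  have hsv : ∀ z : V3 W K, loc (conjAct W c ((3 ^ 1 : ℕ) : ℤ) z) = sgn s • loc z := hs v hv
  have hsμ : s = μ := by
    by_contra hne
    exact hvx (loc_eq_zero_of_sign_ne (conjAct W c _) loc hsv (conjAct_eq_of_mem_selQ W K c n μ hx) hne (h3loc x))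
  -- hence loc_q kills every (−μ)-eigenclass
  have hkill : ∀ (m : Finset {q // IsUAdmissiblePrime W K q}) (y : V3 W K), y ∈ SelQ W K c m (!μ) → loc y = 0 :=
    fun m y hy ↦ loc_eq_zero_of_sign_ne (conjAct W c _) loc hsv (conjAct_eq_of_mem_selQ W K c m (!μ) hy)
      (by rw [hsμ]; cases μ <;> decide) (h3loc y)
  -- zero classes are Kummer and ordinary
  have hKumTor : ∀ y : V3 W K, loc y = 0 →
      y ∈ selmerLocalKer (W.baseChange K) (v.adicCompletion K) ((3 ^ 1 : ℕ) : ℤ) := fun y hy ↦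
    (W.baseChange K).torsionLocalKer_le_selmerLocalKer (v.adicCompletion K) _ (AddMonoidHom.mem_ker.mpr hy)
  have hOrdTor : ∀ y : V3 W K, loc y = 0 →
      y ∈ (W.baseChange K).ordinaryLocalKer (v.adicCompletion K) ((3 ^ 1 : ℕ) : ℤ) := fun y hy ↦
    torsionLocalKer_le_ordinaryLocalKer W K _ _ (AddMonoidHom.mem_ker.mpr hy)
  -- the one-prime step (zhang3-p1), in membership form at the unique place v
  have hstep : ∀ (ν : Bool) (y : V3 W K),
      (y ∈ SelQ W K c (insert q n) ν ∧ y ∈ selmerLocalKer (W.baseChange K) (v.adicCompletion K) ((3 ^ 1 : ℕ) : ℤ)) ↔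
      (y ∈ SelQ W K c n ν ∧ y ∈ (W.baseChange K).ordinaryLocalKer (v.adicCompletion K) ((3 ^ 1 : ℕ) : ℤ)) := by
    intro ν y
    have h' := SetLike.ext_iff.mp (selQ_insert_inf_kummer_eq W K c n q hqn ν) y
    simp only [Submodule.mem_inf, AddSubgroup.mem_toZModSubmodule, AddSubgroup.mem_iInf] at h'
    constructor
    · rintro ⟨h1, h2⟩
      obtain ⟨h1', h2'⟩ := h'.mp ⟨h1, fun v' hv' ↦ by rw [huniq v' hv']; exact h2⟩
      exact ⟨h1', h2' v hv⟩
    · rintro ⟨h1, h2⟩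
      obtain ⟨h1', h2'⟩ := h'.mpr ⟨h1, fun v' hv' ↦ by rw [huniq v' hv']; exact h2⟩
      exact ⟨h1', h2' v hv⟩
  -- the KERNEL DESCRIPTION (Zhang Prop 5.4) on the μ-side
  have hker : ∀ y : V3 W K, y ∈ SelQ W K c (insert q n) μ ↔ (y ∈ SelQ W K c n μ ∧ loc y = 0) := by
    intro y
    constructor
    · intro hy
      have hmono := selRelQ_mono W K c (insert q n)
        (S := (∅ : Set {q // IsUAdmissiblePrime W K q})) (S' := {q}) (Set.empty_subset _) μ
      rw [← selQ_eq_selRelQ_empty] at hmono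
      have hyR : y ∈ SelRelQ W K c (insert q n) {q} μ := hmono hy
      have hxR : x ∈ SelRelQ W K c (insert q n) {q} μ := relaxation_le W K c n q {q} μ hqn (Set.mem_singleton q) hx
      have hy0 : loc y = 0 :=
        htrans q v hv x y (mem_selmerLocalKer_of_mem_selQ W K c n q hqn v hv μ hx)
          (mem_ordinaryLocalKer_of_mem_selQ_insert W K c n q v hv μ hy) (hiso n q μ hqn v hv y hyR x hxR hvx)
      exact ⟨((hstep μ y).mp ⟨hy, hKumTor y hy0⟩).1, hy0⟩
    · rintro ⟨hy, hy0⟩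
      exact ((hstep μ y).mpr ⟨hy, hOrdTor y hy0⟩).1
  -- codimension exactly one: rank–nullity against the line (Line), over ZMod 3
  letI : Module (ZMod 3) (discreteH1 (Field.absoluteGaloisGroup (v.adicCompletion K))
      (AddSubgroup.torsionBy (localPoints (W.baseChange K) (v.adicCompletion K)) ((3 ^ 1 : ℕ) : ℤ))) :=
    AddCommGroup.zmodModule (fun z ↦ by
      have h := zsmul_discreteH1_torsion ((3 ^ 1 : ℕ) : ℤ) z
      rw [natCast_zsmul] at h
      simpa using h)
  set locZ := loc.toZModLinearMap 3 with hlocZ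
  have hlocZ_apply : ∀ y : V3 W K, locZ y = loc y := fun _ ↦ rfl
  obtain ⟨ℓ, hℓ⟩ := hline q v hv
  haveI : FiniteDimensional (ZMod 3) (SelQ W K c n μ) := finiteDimensional_selQ W K c n μ
  haveI : FiniteDimensional (ZMod 3) (Submodule.span (ZMod 3) ({ℓ} : Set _)) :=
    FiniteDimensional.span_of_finite (ZMod 3) (Set.finite_singleton ℓ)
  have hfr : finrank (ZMod 3) ↥(SelQ W K c n μ ⊓ LinearMap.ker locZ) + 1 = finrank (ZMod 3) (SelQ W K c n μ) := by
    refine ZhangInduction.finrank_inf_ker_add_one_of_line (SelQ W K c n μ) locZ (Submodule.span (ZMod 3) {ℓ})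
      ((finrank_span_le_card _).trans (by simp)) ?_ ⟨x, hx, by rw [hlocZ_apply]; exact hvx⟩
    intro y hy
    obtain ⟨a, ha⟩ := hℓ y (mem_selmerLocalKer_of_mem_selQ W K c n q hqn v hv μ hy)
    rw [Submodule.mem_span_singleton]
    exact ⟨(a : ZMod 3), by rw [hlocZ_apply, ha, Int.cast_smul_eq_zsmul]⟩
  have heq : SelQ W K c (insert q n) μ = SelQ W K c n μ ⊓ LinearMap.ker locZ := by
    ext y
    rw [Submodule.mem_inf, LinearMap.mem_ker, hlocZ_apply]
    exact hker y
  refine ⟨q, hqn, fun hxq ↦ hvx ((hker x).mp hxq).2, fun y hy ↦ ((hker y).mp hy).1, by rw [heq]; exact hfr, ?_⟩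
  -- the (−μ)-side is untouched
  ext y
  constructor
  · intro hy
    exact ((hstep (!μ) y).mp ⟨hy, hKumTor y (hkill _ y hy)⟩).1
  · intro hy
    exact ((hstep (!μ) y).mpr ⟨hy, hOrdTor y (hkill _ y hy)⟩).1

end RankLowering

/-! ## §4 The registered stub signature from the inputs, frame-wise (CONDITIONAL; the owner assembles) -/

section Stub

/-- **`stub_levelRaisingAtThree` (registered METHOD skeleton v2t of crux 19574, plan g26 17:02Z) FROM THE FIVE
LOCAL–GLOBAL INPUTS + (A6⁰), supplied frame-wise.** The conclusion is the registered stub signature VERBATIM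
((A1) rank lowering + (A6⁰) non-zero rank at even levels, for the canonical spaces `SelQ` at every Hoffstein–Luo A1
frame); the hypothesis asks, at every such frame and for every complex conjugation `c ≠ 1` and the `ZMod 3`-structure
of `H¹(K, E[3])`: (Cheb) Čebotarev with the sign rule, (Equiv) scalar sign of complex conjugation on `H¹(K_q, E[3])`,
(Line) the Kummer image at `q` is a line, (Trans) Kummer ∩ ordinary = 0 at `q`, (Iso) Poitou–Tate isotropy at `q`
(all at unipotent-admissible `q`; koly MEMO-v1–v2 U1–U4, BD05 L.2.6 ∕ Thm 3.2, Zhang Prop 5.4 ∕ L.7.3 ∕ (9.2)), and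
(A6⁰) itself [Zhang Thm 7.1 + root number −1; at 3: R-SU3 + B♭; at level ∅: zhang3-p1
`finrank_selQ_empty_add_ne_zero_of_not_isOfFinAddOrder` from one point of infinite order]. CONDITIONAL on that
hypothesis; nothing is booked; this seat does not claim the stub (the item owner assembles via
`ZhangSharpFrameAtThreeHL_of`). [cite: WZhang2014, Prop. 5.4, Lemma 7.3, Thm. 7.1, §9 (9.1)–(9.3)]
[cite: BertoliniDarmon2005, Lemma 2.6, Thm. 3.2] -/
theorem stub_levelRaisingAtThree_of_localGlobal
    (hLG : ∀ (W : WeierstrassCurve ℚ) [W.IsElliptic] [W.IsGloballyMinimal] [NeZero (W.conductorNorm ℤ)] (K : Type)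
      [Field K] [NumberField K] (Dt : ModularParametrizationData W (W.conductorNorm ℤ)) (β : ℤ) (ι : K →+* ℂ),
      Summit.BirchSwinnertonDyer.Rank1Residual.ClassX11b W 3 → W.HasMultiplicativeReductionAtPrime 3 →
      Literature.NumberTheory.EllipticCurves.Rank1Residual.Surj W 3 →
      Literature.NumberTheory.EllipticCurves.Rank1Residual.Ram W 3 → ¬ 3 ∣ W.tamagawaProduct →
      IsImaginaryQuadratic K → Odd (NumberField.discr K) → SatisfiesHeegnerHypothesis (W.conductorNorm ℤ) K →
      (W.quadraticTwist (NumberField.discr K : ℚ)).entireLFunction 1 ≠ 0 → NumberField.discr K ≠ -3 →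
      (4 * (W.conductorNorm ℤ : ℤ)) ∣ β ^ 2 - NumberField.discr K → ¬ (3 : ℤ) ∣ Dt.c →
      ∀ (c : K ≃ₐ[ℚ] K), c ≠ 1 → ∀ [Module (ZMod 3) (V3 W K)],
      -- (Cheb)
      (∀ (n : Finset {q // IsUAdmissiblePrime W K q}) (μ : Bool) (x : V3 W K), x ∈ SelQ W K c n μ → x ≠ 0 →
        ∃ q : {q // IsUAdmissiblePrime W K q}, q ∉ n ∧ ∃ v : HeightOneSpectrum (𝓞 K),
          ((q : ℕ) : 𝓞 K) ∈ v.asIdeal ∧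
            (W.baseChange K).torsionLocMap (v.adicCompletion K) ((3 ^ 1 : ℕ) : ℤ) x ≠ 0) ∧
      -- (Equiv)
      (∀ q : {q // IsUAdmissiblePrime W K q}, ∃ s : Bool, ∀ v : HeightOneSpectrum (𝓞 K),
        ((q : ℕ) : 𝓞 K) ∈ v.asIdeal → ∀ z : V3 W K,
          (W.baseChange K).torsionLocMap (v.adicCompletion K) ((3 ^ 1 : ℕ) : ℤ) (conjAct W c ((3 ^ 1 : ℕ) : ℤ) z) =
            sgn s • (W.baseChange K).torsionLocMap (v.adicCompletion K) ((3 ^ 1 : ℕ) : ℤ) z) ∧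
      -- (Line)
      (∀ (q : {q // IsUAdmissiblePrime W K q}) (v : HeightOneSpectrum (𝓞 K)), ((q : ℕ) : 𝓞 K) ∈ v.asIdeal →
        ∃ ℓ, ∀ y ∈ selmerLocalKer (W.baseChange K) (v.adicCompletion K) ((3 ^ 1 : ℕ) : ℤ),
          ∃ a : ℤ, (W.baseChange K).torsionLocMap (v.adicCompletion K) ((3 ^ 1 : ℕ) : ℤ) y = a • ℓ) ∧
      -- (Trans)
      (∀ (q : {q // IsUAdmissiblePrime W K q}) (v : HeightOneSpectrum (𝓞 K)), ((q : ℕ) : 𝓞 K) ∈ v.asIdeal →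
        ∀ y z : V3 W K, y ∈ selmerLocalKer (W.baseChange K) (v.adicCompletion K) ((3 ^ 1 : ℕ) : ℤ) →
          z ∈ (W.baseChange K).ordinaryLocalKer (v.adicCompletion K) ((3 ^ 1 : ℕ) : ℤ) →
          (∃ a : ℤ, (W.baseChange K).torsionLocMap (v.adicCompletion K) ((3 ^ 1 : ℕ) : ℤ) z =
            a • (W.baseChange K).torsionLocMap (v.adicCompletion K) ((3 ^ 1 : ℕ) : ℤ) y) →
          (W.baseChange K).torsionLocMap (v.adicCompletion K) ((3 ^ 1 : ℕ) : ℤ) z = 0) ∧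
      -- (Iso)
      (∀ (n : Finset {q // IsUAdmissiblePrime W K q}) (q : {q // IsUAdmissiblePrime W K q}) (μ : Bool),
        q ∉ n → ∀ v : HeightOneSpectrum (𝓞 K), ((q : ℕ) : 𝓞 K) ∈ v.asIdeal →
        ∀ y ∈ SelRelQ W K c (insert q n) {q} μ, ∀ z ∈ SelRelQ W K c (insert q n) {q} μ,
          (W.baseChange K).torsionLocMap (v.adicCompletion K) ((3 ^ 1 : ℕ) : ℤ) z ≠ 0 →
          ∃ a : ℤ, (W.baseChange K).torsionLocMap (v.adicCompletion K) ((3 ^ 1 : ℕ) : ℤ) y =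
            a • (W.baseChange K).torsionLocMap (v.adicCompletion K) ((3 ^ 1 : ℕ) : ℤ) z) ∧
      -- (A6⁰) non-zero total rank at even levels
      (∀ (n : Finset {q // IsUAdmissiblePrime W K q}), Even n.card →
        finrank (ZMod 3) (SelQ W K c n true) + finrank (ZMod 3) (SelQ W K c n false) ≠ 0)) :
    ∀ (W : WeierstrassCurve ℚ) [W.IsElliptic] [W.IsGloballyMinimal] [NeZero (W.conductorNorm ℤ)] (K : Type)
      [Field K] [NumberField K] (Dt : ModularParametrizationData W (W.conductorNorm ℤ)) (β : ℤ) (ι : K →+* ℂ),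
      Summit.BirchSwinnertonDyer.Rank1Residual.ClassX11b W 3 → W.HasMultiplicativeReductionAtPrime 3 →
      Literature.NumberTheory.EllipticCurves.Rank1Residual.Surj W 3 →
      Literature.NumberTheory.EllipticCurves.Rank1Residual.Ram W 3 → ¬ 3 ∣ W.tamagawaProduct →
      IsImaginaryQuadratic K → Odd (NumberField.discr K) → SatisfiesHeegnerHypothesis (W.conductorNorm ℤ) K →
      (W.quadraticTwist (NumberField.discr K : ℚ)).entireLFunction 1 ≠ 0 → NumberField.discr K ≠ -3 →
      (4 * (W.conductorNorm ℤ : ℤ)) ∣ β ^ 2 - NumberField.discr K → ¬ (3 : ℤ) ∣ Dt.c →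
      ∀ (c : K ≃ₐ[ℚ] K), c ≠ 1 → ∀ [Module (ZMod 3) (V3 W K)],
      -- (A1) rank lowering at one new unipotent-admissible prime, (9.1)–(9.2)
      (∀ (n : Finset {q // IsUAdmissiblePrime W K q}) (μ : Bool) (x : V3 W K),
        x ∈ SelQ W K c n μ → x ≠ 0 →
        ∃ q : {q // IsUAdmissiblePrime W K q}, q ∉ n ∧ x ∉ SelQ W K c (insert q n) μ ∧
          SelQ W K c (insert q n) μ ≤ SelQ W K c n μ ∧
          finrank (ZMod 3) (SelQ W K c (insert q n) μ) + 1 = finrank (ZMod 3) (SelQ W K c n μ) ∧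
          SelQ W K c (insert q n) (!μ) = SelQ W K c n (!μ)) ∧
      -- (A6⁰) non-zero total rank at even levels
      (∀ (n : Finset {q // IsUAdmissiblePrime W K q}), Even n.card →
        finrank (ZMod 3) (SelQ W K c n true) + finrank (ZMod 3) (SelQ W K c n false) ≠ 0) := by
  intro W _ _ _ K _ _ Dt β ι hX hmult hsurj hram htam hK hodd hH hLt h3 hβ hc c hc1 _
  obtain ⟨hcheb, hequiv, hline, htrans, hiso, hA6⟩ :=
    hLG W K Dt β ι hX hmult hsurj hram htam hK hodd hH hLt h3 hβ hc c hc1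
  exact ⟨selQ_rankLowering_of_localGlobal W K c hcheb hequiv hline htrans hiso, hA6⟩

end Stub

end Summit.BirchSwinnertonDyer.Rank1Residual.X11b.Three.Koly.Method2

end
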